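import Summits.KontsevichZagierPeriods.KontsevichZagierPeriods.Theorems.RootDecompRelativeModAbsoluteCylKernelZeroP1

/-!
# `RegKernelPairDegOne` ⟺ its ONE-CYLINDER form — part 2/2: the converse and the `iff`

Cell `decomp-kz`, lens 3 (decomp-kz-lens-3 g9), §19 (INLINE VARIANT: no Prop-valued `def`; the one-cylinder form is
spelled out in each statement), part 2 of the landing split (part 1 = `RootDecompRelativeModAbsoluteCylKernelZeroP1`:
`regKernelPairDegOne_of_cylKernelZero`; see its module docstring for the overview).  Here:
`cylKernelZero_of_regKernelPairDegOne` (the one-cylinder form is the case `G' = G`, `g' = 0`, `k' = 0` of item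
30572) and `regKernelPairDegOne_iff_cylKernelZero` (item 30572 BY NAME ⟺ its one-cylinder form); three helpers
repeated as PRIVATE copies.  Source: `HOME/decomp-kz-lens-3/g9/landing/RootDecompRelativeModAbsoluteCylKernelZeroInline.lean`
sha256 584099badd18065a (text verbatim, split only; critic decomp-kz-crit-1 CLEARED 2026-08-30T11:25:34Z).
No `sorry`; standard axioms.  References: [cite: KontsevichZagier2001, §1.2 rules (1)]; Bochnak–Coste–Roy 1998 §2.9.
-/

noncomputable section

open Set MeasureTheory Filter Topology
open scoped BigOperators
open Literature.NumberTheory.Transcendental Literature.ModelTheory.ExponentialFields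

namespace Summit.KontsevichZagierPeriods.RootDecompRelativeModAbsolute.Rung30571

namespace RegularisedLogLayer

section CylKernelZeroHelpers

/-- Finite sums of `ℚ`-semialgebraic functions are `ℚ`-semialgebraic (local copy: the landed twin is
`private` in the chain modules). [BCR 1998, Prop. 2.2.6] -/
private theorem isSemialgebraicFunOn_finset_sum₀ {n : ℕ} {s : Set (Fin n → ℝ)} (hs : IsSemialgebraic ℚ s)
    {ι : Type*} (I : Finset ι) {f : ι → (Fin n → ℝ) → ℝ}
    (hf : ∀ i ∈ I, IsSemialgebraicFunOn ℚ s (f i)) :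
    IsSemialgebraicFunOn ℚ s (fun x => ∑ i ∈ I, f i x) := by
  classical
  induction I using Finset.induction_on with
  | empty => exact (isSemialgebraicFunOn_ratCast hs 0).congr fun x _ => by simp
  | insert a I ha ih =>
    have h1 : IsSemialgebraicFunOn ℚ s (f a) := hf a (Finset.mem_insert_self a I)
    have h2 := ih fun i hi => hf i (Finset.mem_insert_of_mem hi)
    refine (IsSemialgebraicFunOn.add_holds h1 h2).congr fun x _ => ?_
    simp only [Pi.add_apply, Finset.sum_insert ha]

/-- **Integrand additivity for a finite family on a common domain.** [KZ 2001, §1.2 rule (1)] -/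
private theorem of_sub_sub_sum_mem_relations₀ {m : ℕ} (k : ℕ) :
    ∀ (V r₀ : KZ.IntegralRep m) (r : Fin k → KZ.IntegralRep m),
      r₀.domain = V.domain → (∀ i, (r i).domain = V.domain) →
      EqOn V.integrand (fun x => r₀.integrand x + ∑ i, (r i).integrand x) V.domain →
      KZ.of V - KZ.of r₀ - ∑ i, KZ.of (r i) ∈ KZ.relations := by
  classical
  induction k with
  | zero =>
    intro V r₀ r h0 hr hV
    simp only [Finset.univ_eq_empty, Finset.sum_empty, sub_zero, add_zero] at hV ⊢
    refine AECongr.of_sub_of_mem_relations_of_indicator_ae V r₀ (ae_of_all _ fun x => ?_)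
    rw [h0]
    by_cases hx : x ∈ V.domain
    · rw [indicator_of_mem hx, indicator_of_mem hx, hV hx]
    · rw [indicator_of_notMem hx, indicator_of_notMem hx]
  | succ k ih =>
    intro V r₀ r h0 hr hV
    have hD : IsSemialgebraic ℚ V.domain := V.isSemialgebraic_domain
    have hs0 : IsSemialgebraicFunOn ℚ V.domain r₀.integrand := by
      rw [← h0]; exact r₀.isSemialgebraicFunOn_integrand
    have hsi : ∀ i, IsSemialgebraicFunOn ℚ V.domain (r i).integrand := by
      intro i; rw [← hr i]; exact (r i).isSemialgebraicFunOn_integrand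
    have hi0 : IntegrableOn r₀.integrand V.domain := by
      rw [← h0]; exact r₀.integrableOn
    have hii : ∀ i, IntegrableOn (r i).integrand V.domain := by
      intro i; rw [← hr i]; exact (r i).integrableOn
    let V' : KZ.IntegralRep m :=
      ⟨V.domain, fun x => r₀.integrand x + ∑ i : Fin k, (r (Fin.castSucc i)).integrand x, hD,
        IsSemialgebraicFunOn.add_holds hs0
          (isSemialgebraicFunOn_finset_sum₀ hD _ fun i _ => hsi (Fin.castSucc i)),
        hi0.add (integrable_finsetSum _ fun i _ => hii (Fin.castSucc i))⟩
    have h1 := ih V' r₀ (fun i => r (Fin.castSucc i)) h0 (fun i => hr _) (fun x _ => rfl)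
    have h2 : KZ.of V - KZ.of V' - KZ.of (r (Fin.last k)) ∈ KZ.integrandAddRel := by
      refine ⟨m, V, V', r (Fin.last k), rfl, hr _, fun x hx => ?_, rfl⟩
      show V.integrand x = (r₀.integrand x + ∑ i : Fin k, (r (Fin.castSucc i)).integrand x) +
          (r (Fin.last k)).integrand x
      rw [hV hx]
      dsimp only
      rw [Fin.sum_univ_castSucc]
      ring
    have e : KZ.of V - KZ.of r₀ - ∑ i, KZ.of (r i) =
        (KZ.of V - KZ.of V' - KZ.of (r (Fin.last k))) +
          (KZ.of V' - KZ.of r₀ - ∑ i : Fin k, KZ.of (r (Fin.castSucc i))) := by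
      rw [Fin.sum_univ_castSucc]; abel
    rw [e]
    exact add_mem (KZ.integrandAddRel_subset_relations h2) h1

/-- The unfolded monomial integrand `c(x) θ^m/(1+θ^e κ(x))` is `ℚ`-semialgebraic on `P × (0,1)`. -/
private theorem isSemialgebraicFunOn_cyl_monomial {P : Set (Fin 1 → ℝ)} (hP : IsSemialgebraic ℚ P)
    {c κ : (Fin 1 → ℝ) → ℝ} (hc : IsSemialgebraicFunOn ℚ P c) (hκs : IsSemialgebraicFunOn ℚ P κ)
    (hκ1 : ∀ x ∈ P, -1 < κ x) (m e : ℕ) :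
    IsSemialgebraicFunOn ℚ (RTerm.cyl P)
      (fun z => c (Fin.init z) * kernel m e (κ (Fin.init z)) (z (Fin.last 1))) := by
  have hcyl := RTerm.isSemialgebraic_cyl hP
  have hsub : RTerm.cyl P ⊆ {z | Fin.init z ∈ P} := fun z hz => hz.1
  have hθ : IsSemialgebraicFunOn ℚ (RTerm.cyl P) (fun z : Fin (1 + 1) → ℝ => z (Fin.last 1)) :=
    (isSemialgebraicFunOn_aeval hcyl (MvPolynomial.X (Fin.last 1))).congr fun z _ => by simp
  have hden : IsSemialgebraicFunOn ℚ (RTerm.cyl P)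
      (fun z : Fin (1 + 1) → ℝ => 1 + z (Fin.last 1) ^ e * κ (Fin.init z)) :=
    ((isSemialgebraicFunOn_ratCast hcyl 1).add_holds
      ((isSemialgebraicFunOn_pow hcyl hθ e).mul_holds (hκs.comp_init_mono hcyl hsub))).congr
      fun z _ => by simp
  have hden0 : ∀ z ∈ RTerm.cyl P, 1 + z (Fin.last 1) ^ e * κ (Fin.init z) ≠ 0 := fun z hz =>
    (one_add_pow_mul_pos e (hκ1 _ hz.1) (Ioo_subset_Icc_self hz.2)).ne'
  exact ((hc.comp_init_mono hcyl hsub).mul_holds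
    ((isSemialgebraicFunOn_pow hcyl hθ m).mul_holds (hden.inv hden0))).congr fun z _ => by
      simp [kernel, div_eq_mul_inv]

end CylKernelZeroHelpers

section CylKernelZeroEquiv

/-- **Conversely, the one-cylinder form is the case `G' = G`, `g' = 0`, `k' = 0` of item 30572.** -/
theorem cylKernelZero_of_regKernelPairDegOne
    (h30572 : Summit.KontsevichZagierPeriods.KontsevichZagierPeriods.Theses.RootDecompRelativeModAbsolute.RegKernelPairDegOne) :
    (∀ (P : Set (Fin 1 → ℝ)) (V : KZ.IntegralRep (1 + 1)) (a₀ : (Fin 1 → ℝ) → ℝ) (q : ℕ)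
        (c κ : Fin q → (Fin 1 → ℝ) → ℝ) (M e : Fin q → ℕ),
        IsSemialgebraic ℚ P → IsSemialgebraicFunOn ℚ P a₀ → IntegrableOn a₀ P →
        (∀ i, IsSemialgebraicFunOn ℚ P (c i)) → (∀ i, IsSemialgebraicFunOn ℚ P (κ i)) →
        (∀ i, e i = 1 ∨ e i = 2) → (∀ i, ∀ x ∈ P, -1 < κ i x) →
        (∀ i, IntegrableOn (fun z : Fin (1 + 1) → ℝ =>
          c i (Fin.init z) * (z (Fin.last 1) ^ M i / (1 + z (Fin.last 1) ^ e i * κ i (Fin.init z))))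
          {z : Fin (1 + 1) → ℝ | (Fin.init z : Fin 1 → ℝ) ∈ P ∧ z (Fin.last 1) ∈ Set.Ioo 0 1}) →
        (∀ i, IntegrableOn (fun x => c i x * ∫ θ in Set.Ioo (0 : ℝ) 1, θ ^ M i / (1 + θ ^ e i * κ i x)) P) →
        V.domain = {z : Fin (1 + 1) → ℝ | (Fin.init z : Fin 1 → ℝ) ∈ P ∧ z (Fin.last 1) ∈ Set.Ioo 0 1} →
        Set.EqOn V.integrand (fun z => a₀ (Fin.init z) +
          ∑ i, c i (Fin.init z) * (z (Fin.last 1) ^ M i / (1 + z (Fin.last 1) ^ e i * κ i (Fin.init z))))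
          V.domain →
        (∀ᵐ x : (Fin 1 → ℝ), x ∈ P →
          a₀ x + ∑ i, c i x * ∫ θ in Set.Ioo (0 : ℝ) 1, θ ^ M i / (1 + θ ^ e i * κ i x) = 0) →
        KZ.of V ∈ KZ.relations) := by
  intro P V a₀ q c κ M e hP ha₀ ha₀i hc hκs hem hκ1 hci hL1 hdom hint hzero
  classical
  have hcyl : IsSemialgebraic ℚ (RTerm.cyl P) := RTerm.isSemialgebraic_cyl hP
  have hcylm : MeasurableSet (RTerm.cyl P) := hcyl.measurableSet_holds
  have hUsa : ∀ i, IsSemialgebraicFunOn ℚ (RTerm.cyl P) (fun z : Fin (1 + 1) → ℝ =>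
      c i (Fin.init z) * (z (Fin.last 1) ^ M i / (1 + z (Fin.last 1) ^ e i * κ i (Fin.init z)))) :=
    fun i => by
      simpa only [kernel] using isSemialgebraicFunOn_cyl_monomial hP (hc i) (hκs i) (hκ1 i) (M i) (e i)
  let g : KZ.IntegralRep 1 := ⟨P, a₀, hP, ha₀, ha₀i⟩
  let g' : KZ.IntegralRep 1 := ⟨P, fun _ => 0, hP,
    (isSemialgebraicFunOn_ratCast hP 0).congr (fun x _ => by simp), integrableOn_zero⟩
  let U : Fin q → KZ.IntegralRep (1 + 1) := fun i => ⟨RTerm.cyl P, fun z =>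
      c i (Fin.init z) * (z (Fin.last 1) ^ M i / (1 + z (Fin.last 1) ^ e i * κ i (Fin.init z))),
    hcyl, hUsa i, hci i⟩
  have hae : ∀ᵐ x : (Fin 1 → ℝ), P.indicator (fun x => a₀ x +
      ∑ i, c i x * ∫ θ in Set.Ioo (0 : ℝ) 1, θ ^ M i / (1 + θ ^ e i * κ i x)) x =
      P.indicator (fun x => (0 : ℝ) + ∑ j : Fin 0, (Fin.elim0 j : (Fin 1 → ℝ) → ℝ) x *
        ∫ θ in Set.Ioo (0 : ℝ) 1, θ ^ (Fin.elim0 j : ℕ) / (1 + θ ^ (Fin.elim0 j : ℕ) *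
          (Fin.elim0 j : (Fin 1 → ℝ) → ℝ) x)) x := by
    filter_upwards [hzero] with x hx
    by_cases hxP : x ∈ P
    · rw [indicator_of_mem hxP, indicator_of_mem hxP, hx hxP]
      simp
    · rw [indicator_of_notMem hxP, indicator_of_notMem hxP]
  have H := h30572 g g' q 0 c κ M e U Fin.elim0 Fin.elim0 Fin.elim0 Fin.elim0 Fin.elim0
    hc hκs hem hκ1 (fun _ => rfl) (fun _ => fun _ _ => rfl) hL1
    (fun j => j.elim0) (fun j => j.elim0) (fun j => j.elim0) (fun j => j.elim0) (fun j => j.elim0)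
    (fun j => j.elim0) (fun j => j.elim0) hae
  rw [Fin.sum_univ_zero, add_zero] at H
  have hg' : KZ.of g' ∈ KZ.relations := KZ.of_mem_relations_of_eqOn_zero g' fun _ _ => rfl
  -- `[V] ≡ [B₀] + Σ [Uᵢ]` and `[B₀] ≡ [g]`
  have ha₀c : IsSemialgebraicFunOn ℚ (RTerm.cyl P) (fun z => a₀ (Fin.init z)) :=
    ha₀.comp_init_mono hcyl fun z hz => hz.1
  have ha₀ci : IntegrableOn (fun z : Fin (1 + 1) → ℝ => a₀ (Fin.init z)) (RTerm.cyl P) := by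
    have := integrableOn_cyl_polynomial hP (m := 0) (a := fun _ => a₀) (fun _ => ha₀) (fun _ => ha₀i)
    exact this.congr_fun (fun z _ => by simp) hcylm
  let B₀ : KZ.IntegralRep (1 + 1) := ⟨RTerm.cyl P, fun z => a₀ (Fin.init z), hcyl, ha₀c, ha₀ci⟩
  have hA : KZ.of V - KZ.of B₀ - ∑ i, KZ.of (U i) ∈ KZ.relations := by
    refine of_sub_sub_sum_mem_relations₀ q V B₀ U hdom.symm (fun i => hdom.symm) fun z hz => ?_
    rw [hint hz]
  have hB₀ : KZ.of B₀ - KZ.of g ∈ KZ.relations := by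
    obtain ⟨hTb, hfold⟩ := foldsTo_cyl_polynomial B₀ hP (m := 0) (a := fun _ => a₀)
      (fun _ => ha₀) rfl (fun z _ => by
        show a₀ (Fin.init z) = _
        simp)
    have h1 : KZ.of B₀ - KZ.of (RTerm.baseRep _ hTb) ∈ KZ.relations := by
      have := hfold.1
      rwa [RTerm.unfold_base] at this
    have h2 : KZ.of (RTerm.baseRep _ hTb) - KZ.of g ∈ KZ.relations := by
      refine AECongr.of_sub_of_mem_relations_of_indicator_ae _ g (ae_of_all _ fun x => ?_)
      show P.indicator (fun x => ∑ k : Fin (0 + 1), a₀ x / ((k : ℕ) + 1)) x = P.indicator a₀ x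
      congr 1
      funext y
      simp
    have e : KZ.of B₀ - KZ.of g = (KZ.of B₀ - KZ.of (RTerm.baseRep _ hTb)) +
        (KZ.of (RTerm.baseRep _ hTb) - KZ.of g) := by abel
    rw [e]
    exact add_mem h1 h2
  have e : KZ.of V = (KZ.of V - KZ.of B₀ - ∑ i, KZ.of (U i)) + (KZ.of B₀ - KZ.of g) +
      ((KZ.of g + ∑ i, KZ.of (U i)) - KZ.of g') + KZ.of g' := by abel
  rw [e]
  exact add_mem (add_mem (add_mem hA hB₀) H) hg'

/-- **The certified translation:** item 30572 `RegKernelPairDegOne` ⟺ its one-cylinder form. -/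
theorem regKernelPairDegOne_iff_cylKernelZero :
    Summit.KontsevichZagierPeriods.KontsevichZagierPeriods.Theses.RootDecompRelativeModAbsolute.RegKernelPairDegOne ↔
    (∀ (P : Set (Fin 1 → ℝ)) (V : KZ.IntegralRep (1 + 1)) (a₀ : (Fin 1 → ℝ) → ℝ) (q : ℕ)
        (c κ : Fin q → (Fin 1 → ℝ) → ℝ) (M e : Fin q → ℕ),
        IsSemialgebraic ℚ P → IsSemialgebraicFunOn ℚ P a₀ → IntegrableOn a₀ P →
        (∀ i, IsSemialgebraicFunOn ℚ P (c i)) → (∀ i, IsSemialgebraicFunOn ℚ P (κ i)) →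
        (∀ i, e i = 1 ∨ e i = 2) → (∀ i, ∀ x ∈ P, -1 < κ i x) →
        (∀ i, IntegrableOn (fun z : Fin (1 + 1) → ℝ =>
          c i (Fin.init z) * (z (Fin.last 1) ^ M i / (1 + z (Fin.last 1) ^ e i * κ i (Fin.init z))))
          {z : Fin (1 + 1) → ℝ | (Fin.init z : Fin 1 → ℝ) ∈ P ∧ z (Fin.last 1) ∈ Set.Ioo 0 1}) →
        (∀ i, IntegrableOn (fun x => c i x * ∫ θ in Set.Ioo (0 : ℝ) 1, θ ^ M i / (1 + θ ^ e i * κ i x)) P) →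
        V.domain = {z : Fin (1 + 1) → ℝ | (Fin.init z : Fin 1 → ℝ) ∈ P ∧ z (Fin.last 1) ∈ Set.Ioo 0 1} →
        Set.EqOn V.integrand (fun z => a₀ (Fin.init z) +
          ∑ i, c i (Fin.init z) * (z (Fin.last 1) ^ M i / (1 + z (Fin.last 1) ^ e i * κ i (Fin.init z))))
          V.domain →
        (∀ᵐ x : (Fin 1 → ℝ), x ∈ P →
          a₀ x + ∑ i, c i x * ∫ θ in Set.Ioo (0 : ℝ) 1, θ ^ M i / (1 + θ ^ e i * κ i x) = 0) →
        KZ.of V ∈ KZ.relations) :=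
  ⟨cylKernelZero_of_regKernelPairDegOne, regKernelPairDegOne_of_cylKernelZero⟩

end CylKernelZeroEquiv

end RegularisedLogLayer

end Summit.KontsevichZagierPeriods.RootDecompRelativeModAbsolute.Rung30571

end
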